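import Summits.CriticalPhenomena.Ising3DConformalLimit.Theorems.ArmDressingArmDressingGlueInvQTransport
import HarnessLib

/-!
# Crux `ArmDressingGlue` (stmt-CriticalPhenomena-15700), stub 3' — part 4a: the sandwich for the arm-factor
# witnesses `W`, `W*` under the unit inversion

Camia–Feng §3.2.3 transposed, second half, lattice side.  System `Σ = (c = z, r, z, a = 1)` at the points
`z_j ≠ 0` and the inverted system `Σ* = (c*, r*, z* = z/‖z‖², b)`, `b_j = ‖z_j‖⁻²`.  For witnesses `W` of
`CFam Σ` and `W*` of `CFam Σ*` (clause (ii) of crux C), given crux A (limit law `lam` of the CROSS connection law,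
inversion invariant) and `CrossLawPositive` (`lam > 0`):

* `cFam_ratio_tendsto` — z-side: for small `η`, `lam(p_N(η'))/lam(p_M(η', η)) → W η` as `η' → 0⁺`, where
  `p_N(η') = (z_j, η')_j ++ (z_j, -r)_j` (inner balls ++ exteriors of the `D_j`) and
  `p_M(η', t) = (z_j, η')_j ++ (z_j, -t)_j` (inner balls ++ exteriors of the middle balls `B(z_j, t)`);
* `cFam_star_sandwich` — z*-side: with the IMAGE inner family `ginv (z_j, η')`, the numerator law is again
  `lam(p_N)` (inversion clause), while the exteriors of the CENTRED middle balls `B(z*_j, η b_j)` are squeezed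
  between the images of the exteriors of `B(z_j, η(1∓ε))` (`Literature/Geometry/Euclidean/InversionBalls.lean`,
  `η ≤ ε‖z_j‖/8`), so by MONOTONICITY of the CROSS law in the outer sets (`Pr_cross_mono_outer`) and positivity,
  `W(η(1-ε)) ≤ W* η ≤ W(η(1+ε))` eventually in `η`, for every `0 < ε < 1`.

Registered bookkeeping stub proved here: `stub_invVSandwich`.  No definitions, no named facts, no sorry.

Reference: F. Camia, Y. Feng, arXiv:2411.01467, §3.2.3 (terms `T₁`, `T₃`, the thinnest annulus containing the
symmetric difference).
-/

noncomputable section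

namespace Summit.CriticalPhenomena.Ising3DConformalLimit.Cruxes.ArmDressingGlue.InvBook

open scoped BigOperators Topology
open Filter Set Metric EuclideanGeometry
open Literature.Probability.LatticeModels Literature.Probability.Percolation
open Literature.Barriers.CriticalPhenomena Literature.Geometry.Euclidean
open Summit.CriticalPhenomena.Ising3DConformalLimit.Theses
open Summit.CriticalPhenomena.Ising3DConformalLimit.Cruxes.ArmDressingGlue.Vocab

/-! ### Laws of the three kinds of families as values of `lam` -/

/-- The law of "inner balls `B̄(z_j, η')` ++ exteriors of `B(z_j, t)`" tends to `lam` of its data. [folklore] -/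
theorem tendsto_Pr_fam_centred {n : ℕ} {R : Set (Fin (n + n) → Fin (n + n) → Prop)}
    {lam : (Fin (n + n) → EuclideanSpace ℝ (Fin 3) × ℝ) → ℝ} (hlam : BallLaw (n + n) R lam)
    (z : Fin n → EuclideanSpace ℝ (Fin 3)) {η' t : ℝ} (hη' : 0 < η') (ht : 0 < t) :
    Tendsto (fun δ => Pr (n + n) (fam n δ (fun j => closedBall (z j) η') (fun j => (ball (z j) t)ᶜ)) R)
      (𝓝[>] 0) (𝓝 (lam (Fin.append (fun j => (z j, η')) (fun j => (z j, -t))))) := by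
  have h := hlam.2.1 _ (radii_ne_zero_append z hη'.ne' ht.ne')
  refine h.congr fun δ => ?_
  exact congrArg (fun K => Pr (n + n) K R) (disc_gball_append δ z (fun _ => η') z (fun _ => t) (fun _ => hη') fun _ => ht)

/-- The law of the IMAGE family "`ginv (z_j, η')` ++ exteriors of the image balls of `B(z_j, t)`" tends to `lam`
of the UN-inverted data (inversion clause of A; `0 < η', t < ‖z_j‖`). [cite: CamiaFeng2025, §3.2.3] -/
theorem tendsto_Pr_fam_image {n : ℕ} {R : Set (Fin (n + n) → Fin (n + n) → Prop)}
    {lam : (Fin (n + n) → EuclideanSpace ℝ (Fin 3) × ℝ) → ℝ} (hlam : BallLaw (n + n) R lam)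
    (z : Fin n → EuclideanSpace ℝ (Fin 3)) {η' t : ℝ} (hη' : 0 < η') (hη'z : ∀ j, η' < ‖z j‖) (ht : 0 < t)
    (htz : ∀ j, t < ‖z j‖) :
    Tendsto (fun δ => Pr (n + n) (fam n δ
      (fun j => closedBall ((‖z j‖ ^ 2 - η' ^ 2)⁻¹ • z j) (η' / (‖z j‖ ^ 2 - η' ^ 2)))
      (fun j => (ball ((‖z j‖ ^ 2 - t ^ 2)⁻¹ • z j) (t / (‖z j‖ ^ 2 - t ^ 2)))ᶜ)) R)
      (𝓝[>] 0) (𝓝 (lam (Fin.append (fun j => (z j, η')) (fun j => (z j, -t))))) := by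
  have hρ : ∀ j, 0 < η' / (‖z j‖ ^ 2 - η' ^ 2) := fun j => ginv_radius_pos hη' (hη'z j)
  have ht' : ∀ j, 0 < t / (‖z j‖ ^ 2 - t ^ 2) := fun j => ginv_radius_pos ht (htz j)
  have hrad' : ∀ i, (ginv (Fin.append (fun j => (z j, η')) (fun j => (z j, -t)) i)).2 ≠ 0 := by
    intro i
    rw [congrFun (ginv_append_data z η' t) i]
    refine Fin.addCases (fun j => ?_) (fun j => ?_) i
    · simp only [Fin.append_left]; exact (hρ j).ne'
    · simp only [Fin.append_right]; exact neg_ne_zero.2 (ht' j).ne'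
  have h := hlam.2.1 _ hrad'
  rw [hlam.2.2.2.2.2 _ (guard_append z hη' hη'z ht htz)] at h
  refine h.congr fun δ => ?_
  have hfam := disc_gball_append δ (fun j => (‖z j‖ ^ 2 - η' ^ 2)⁻¹ • z j)
    (fun j => η' / (‖z j‖ ^ 2 - η' ^ 2)) (fun j => (‖z j‖ ^ 2 - t ^ 2)⁻¹ • z j)
    (fun j => t / (‖z j‖ ^ 2 - t ^ 2)) hρ ht'
  rw [← hfam]
  refine congrArg (fun K => Pr (n + n) K R) ?_
  funext i
  exact congrArg (fun p => disc δ (gball p)) (congrFun (ginv_append_data z η' t) i)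

/-- The law of "image inner balls ++ exteriors of the CENTRED middle balls `B(z*_j, η b_j)`" tends to `lam` of its
data. [folklore] -/
theorem tendsto_Pr_fam_star_mid {n : ℕ} {R : Set (Fin (n + n) → Fin (n + n) → Prop)}
    {lam : (Fin (n + n) → EuclideanSpace ℝ (Fin 3) × ℝ) → ℝ} (hlam : BallLaw (n + n) R lam)
    (z : Fin n → EuclideanSpace ℝ (Fin 3)) {η' η : ℝ} (hη' : 0 < η') (hη'z : ∀ j, η' < ‖z j‖) (hη : 0 < η)
    (hz : ∀ j, z j ≠ 0) :
    Tendsto (fun δ => Pr (n + n) (fam n δ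
      (fun j => closedBall ((‖z j‖ ^ 2 - η' ^ 2)⁻¹ • z j) (η' / (‖z j‖ ^ 2 - η' ^ 2)))
      (fun j => (ball (inversion 0 1 (z j)) (η / ‖z j‖ ^ 2))ᶜ)) R)
      (𝓝[>] 0) (𝓝 (lam (Fin.append
        (fun j => ((‖z j‖ ^ 2 - η' ^ 2)⁻¹ • z j, η' / (‖z j‖ ^ 2 - η' ^ 2)))
        (fun j => (inversion 0 1 (z j), -(η / ‖z j‖ ^ 2)))))) := by
  have hρ : ∀ j, 0 < η' / (‖z j‖ ^ 2 - η' ^ 2) := fun j => ginv_radius_pos hη' (hη'z j)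
  have hR : ∀ j, 0 < η / ‖z j‖ ^ 2 := fun j => div_pos hη (pow_pos (norm_pos_iff.2 (hz j)) 2)
  have hrad : ∀ i, (Fin.append (fun j => ((‖z j‖ ^ 2 - η' ^ 2)⁻¹ • z j, η' / (‖z j‖ ^ 2 - η' ^ 2)))
      (fun j => (inversion 0 1 (z j), -(η / ‖z j‖ ^ 2))) i).2 ≠ 0 := by
    intro i
    refine Fin.addCases (fun j => ?_) (fun j => ?_) i
    · simp only [Fin.append_left]; exact (hρ j).ne'
    · simp only [Fin.append_right]; exact neg_ne_zero.2 (hR j).ne'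
  refine (hlam.2.1 _ hrad).congr fun δ => ?_
  exact congrArg (fun K => Pr (n + n) K R) (disc_gball_append δ _ _ _ _ hρ hR)

/-! ### z-side: the `CFam` witness as a limit of ratios of `lam` -/

/-- **z-side.**  For the system `(z, r, z, 1)` with witness `W`: for small `η`,
`lam(p_N(η'))/lam(p_M(η', η)) → W η` as `η' → 0⁺` (centred inner family; A and positivity identify the ratio
limits). [cite: CamiaFeng2025, Lemma 15] -/
theorem cFam_ratio_tendsto {n : ℕ} {z : Fin n → EuclideanSpace ℝ (Fin 3)} {r : ℝ} (hr : 0 < r) {W : ℝ → ℝ}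
    (hW : CFam n z (fun _ => r) z (fun _ => 1) W)
    {lam : (Fin (n + n) → EuclideanSpace ℝ (Fin 3) × ℝ) → ℝ} (hlam : BallLaw (n + n) (CROSS n) lam)
    (hlampos : ∀ p : Fin (n + n) → EuclideanSpace ℝ (Fin 3) × ℝ, (∀ i, (p i).2 ≠ 0) → 0 < lam p) :
    ∀ᶠ η in 𝓝[>] (0:ℝ), Tendsto (fun η' =>
      lam (Fin.append (fun j => (z j, η')) (fun j => (z j, -r))) /
        lam (Fin.append (fun j => (z j, η')) (fun j => (z j, -η)))) (𝓝[>] 0) (𝓝 (W η)) := by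
  have h1 := hW (fun _ j => z j) (fun η _ => η) (fun _ => tendsto_nhdsWithin_of_tendsto_nhds tendsto_id)
    (by filter_upwards [self_mem_nhdsWithin] with η hη j using ⟨hη, mem_ball_self (half_pos hη)⟩)
  filter_upwards [h1, self_mem_nhdsWithin] with η hη hη0
  obtain ⟨Λ, hΛ, hΛW⟩ := hη
  refine hΛW.congr' ?_
  filter_upwards [hΛ, self_mem_nhdsWithin] with η' h hη'0
  have hN := tendsto_Pr_fam_centred (R := CROSS n) hlam z (η' := η') (t := r) hη'0 hr
  have hD := tendsto_Pr_fam_centred (R := CROSS n) hlam z (η' := η') (t := η) hη'0 hη0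
  simp only [mul_one] at h
  exact tendsto_nhds_unique h (hN.div hD (hlampos _ (radii_ne_zero_append z (hη'0 : 0 < η').ne'
    (hη0 : 0 < η).ne')).ne')

/-- `η ↦ ηκ` maps `0⁺` to `0⁺` (`κ > 0`). [folklore] -/
theorem tendsto_mul_const_nhdsGT {κ : ℝ} (hκ : 0 < κ) :
    Tendsto (fun η : ℝ => η * κ) (𝓝[>] (0:ℝ)) (𝓝[>] 0) :=
  (MoebiusLimitExistsNegative.tendsto_const_mul_nhdsGT hκ).congr fun η => mul_comm κ η

/-! ### z*-side: the sandwich -/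

/-- **The sandwich.**  For `0 < ε < 1`, witnesses `W` of `CFam (z, r, z, 1)` and `W*` of the inverted system
`CFam (c*, r*, z*, b)` (`b_j = ‖z_j‖⁻²`) satisfy `W(η(1-ε)) ≤ W* η ≤ W(η(1+ε))` for all small `η > 0`, given crux A
and `CrossLawPositive`. [cite: CamiaFeng2025, §3.2.3] -/
theorem cFam_star_sandwich (hPos : CrossLawPositive) (hA : ArmDressing.BallConnectivityMoebius) {n : ℕ}
    {z : Fin n → EuclideanSpace ℝ (Fin 3)} {r : ℝ} (hz : ∀ j, z j ≠ 0) (hr : 0 < r) (hrz : ∀ j, r < ‖z j‖)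
    {W Ws : ℝ → ℝ} (hW : CFam n z (fun _ => r) z (fun _ => 1) W)
    (hWs : CFam n (fun j => (‖z j‖ ^ 2 - r ^ 2)⁻¹ • z j) (fun j => r / (‖z j‖ ^ 2 - r ^ 2))
      (fun j => inversion 0 1 (z j)) (fun j => (‖z j‖ ^ 2)⁻¹) Ws)
    {ε : ℝ} (hε : 0 < ε) (hε1 : ε < 1) :
    ∀ᶠ η in 𝓝[>] (0:ℝ), W (η * (1 - ε)) ≤ Ws η ∧ Ws η ≤ W (η * (1 + ε)) := by
  obtain ⟨lam, hlam⟩ := ballConnectivityMoebius_iff.1 hA (n + n) (CROSS n)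
  have hlampos : ∀ p : Fin (n + n) → EuclideanSpace ℝ (Fin 3) × ℝ, (∀ i, (p i).2 ≠ 0) → 0 < lam p :=
    fun p hp => lam_cross_pos hPos hlam p hp
  -- z-side limits at the middle radii `η(1 ± ε)`
  have hV := cFam_ratio_tendsto hr hW hlam hlampos
  have hVp := (tendsto_mul_const_nhdsGT (by linarith : (0:ℝ) < 1 + ε)).eventually hV
  have hVm := (tendsto_mul_const_nhdsGT (by linarith : (0:ℝ) < 1 - ε)).eventually hV
  -- z*-side: the image inner family is admissible
  have hadm : ∀ᶠ η in 𝓝[>] (0:ℝ), ∀ j, 0 < η / (‖z j‖ ^ 2 - η ^ 2) ∧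
      inversion 0 1 (z j) ∈ ball ((‖z j‖ ^ 2 - η ^ 2)⁻¹ • z j) (η / (‖z j‖ ^ 2 - η ^ 2) / 2) := by
    refine eventually_all.2 fun j => ?_
    have hN : 0 < ‖z j‖ := norm_pos_iff.2 (hz j)
    filter_upwards [Ioo_mem_nhdsGT (half_pos hN)] with η hη
    have hηN : η < ‖z j‖ := by linarith [hη.2]
    exact ⟨ginv_radius_pos hη.1 hηN, inversion_mem_ball_image_half hη.1 hη.2⟩
  have hlt : ∀ᶠ η in 𝓝[>] (0:ℝ), ∀ j, η < ‖z j‖ := by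
    refine eventually_all.2 fun j => ?_
    filter_upwards [Ioo_mem_nhdsGT (norm_pos_iff.2 (hz j))] with η hη using hη.2
  have h2 := hWs (fun η j => (‖z j‖ ^ 2 - η ^ 2)⁻¹ • z j) (fun η j => η / (‖z j‖ ^ 2 - η ^ 2))
    (fun j => tendsto_div_sub_sq ‖z j‖ (norm_ne_zero_iff.2 (hz j))) hadm
  -- smallness of the middle radius: `η ≤ ε ‖z_j‖ / 8` and `η (1 + ε) < ‖z_j‖`
  have hsmall : ∀ᶠ η in 𝓝[>] (0:ℝ), ∀ j, η ≤ ε * ‖z j‖ / 8 ∧ η * (1 + ε) < ‖z j‖ := by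
    refine eventually_all.2 fun j => ?_
    have hN : 0 < ‖z j‖ := norm_pos_iff.2 (hz j)
    have hm : 0 < ε * ‖z j‖ / 8 := by positivity
    filter_upwards [Ioc_mem_nhdsGT hm] with η hη
    refine ⟨hη.2, ?_⟩
    nlinarith [hη.2, hε1]
  filter_upwards [hVp, hVm, h2, hsmall, self_mem_nhdsWithin] with η hp hm hη hsm hη0
  have hη0 : 0 < η := hη0
  obtain ⟨Λs, hΛs, hΛsW⟩ := hη
  have hηp : 0 < η * (1 + ε) := by positivity
  have hηm : 0 < η * (1 - ε) := mul_pos hη0 (by linarith)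
  have hηpz : ∀ j, η * (1 + ε) < ‖z j‖ := fun j => (hsm j).2
  have hηmz : ∀ j, η * (1 - ε) < ‖z j‖ := fun j => lt_of_le_of_lt (by nlinarith) (hsm j).2
  -- eventually in `η'`: the starred ratio limit is squeezed between the z-side ratios at `η(1 ∓ ε)`
  have hineq : ∀ᶠ η' in 𝓝[>] (0:ℝ),
      lam (Fin.append (fun j => (z j, η')) (fun j => (z j, -r))) /
          lam (Fin.append (fun j => (z j, η')) (fun j => (z j, -(η * (1 - ε))))) ≤ Λs η' ∧
        Λs η' ≤ lam (Fin.append (fun j => (z j, η')) (fun j => (z j, -r))) /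
          lam (Fin.append (fun j => (z j, η')) (fun j => (z j, -(η * (1 + ε))))) := by
    filter_upwards [hΛs, hadm, hlt, self_mem_nhdsWithin] with η' h hadmη' hltη' hη'0
    have hη'0 : 0 < η' := hη'0
    -- the starred ratio limit is `lam(p_N)/lam(p*)`
    have hN := tendsto_Pr_fam_image (R := CROSS n) hlam z hη'0 hltη' hr hrz
    have hD := tendsto_Pr_fam_star_mid (R := CROSS n) hlam z hη'0 hltη' hη0 hz
    have hDpos : 0 < lam (Fin.append
        (fun j => ((‖z j‖ ^ 2 - η' ^ 2)⁻¹ • z j, η' / (‖z j‖ ^ 2 - η' ^ 2)))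
        (fun j => (inversion 0 1 (z j), -(η / ‖z j‖ ^ 2)))) := by
      refine hlampos _ fun i => ?_
      refine Fin.addCases (fun j => ?_) (fun j => ?_) i
      · simp only [Fin.append_left]; exact (hadmη' j).1.ne'
      · simp only [Fin.append_right]
        exact neg_ne_zero.2 (div_pos hη0 (pow_pos (norm_pos_iff.2 (hz j)) 2)).ne'
    have hmid : (fun j => (ball (inversion 0 1 (z j)) (η * (‖z j‖ ^ 2)⁻¹))ᶜ) =
        fun j => (ball (inversion 0 1 (z j)) (η / ‖z j‖ ^ 2))ᶜ := by
      funext j; rw [div_eq_mul_inv]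
    rw [hmid] at h
    have hΛeq := tendsto_nhds_unique h (hN.div hD hDpos.ne')
    -- the two comparison laws (images of the exteriors of `B(z_j, η(1 ± ε))`) and their limits
    have hP := tendsto_Pr_fam_image (R := CROSS n) hlam z hη'0 hltη' hηp hηpz
    have hM := tendsto_Pr_fam_image (R := CROSS n) hlam z hη'0 hltη' hηm hηmz
    -- monotonicity in the outer sets, eventually in `δ > 0`
    have hle1 : lam (Fin.append (fun j => (z j, η')) (fun j => (z j, -(η * (1 + ε))))) ≤
        lam (Fin.append (fun j => ((‖z j‖ ^ 2 - η' ^ 2)⁻¹ • z j, η' / (‖z j‖ ^ 2 - η' ^ 2)))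
          (fun j => (inversion 0 1 (z j), -(η / ‖z j‖ ^ 2)))) := by
      refine le_of_tendsto_of_tendsto hP hD ?_
      filter_upwards [self_mem_nhdsWithin] with δ hδ
      exact Pr_cross_mono_outer hδ _ _ _ _ _ _ fun j =>
        ball_inversion_subset_image (hz j) hε hε1.le hη0 (hsm j).1
    have hle2 : lam (Fin.append (fun j => ((‖z j‖ ^ 2 - η' ^ 2)⁻¹ • z j, η' / (‖z j‖ ^ 2 - η' ^ 2)))
          (fun j => (inversion 0 1 (z j), -(η / ‖z j‖ ^ 2)))) ≤
        lam (Fin.append (fun j => (z j, η')) (fun j => (z j, -(η * (1 - ε))))) := by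
      refine le_of_tendsto_of_tendsto hD hM ?_
      filter_upwards [self_mem_nhdsWithin] with δ hδ
      exact Pr_cross_mono_outer hδ _ _ _ _ _ _ fun j =>
        image_subset_ball_inversion (hz j) hε hε1 hη0 (hsm j).1
    have hNnn : 0 ≤ lam (Fin.append (fun j => (z j, η')) (fun j => (z j, -r))) :=
      (hlampos _ (radii_ne_zero_append z hη'0.ne' hr.ne')).le
    have hPpos : 0 < lam (Fin.append (fun j => (z j, η')) (fun j => (z j, -(η * (1 + ε))))) :=
      hlampos _ (radii_ne_zero_append z hη'0.ne' hηp.ne')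
    rw [hΛeq]
    exact ⟨div_le_div_of_nonneg_left hNnn hDpos hle2, div_le_div_of_nonneg_left hNnn hPpos hle1⟩
  exact ⟨le_of_tendsto_of_tendsto hm hΛsW (hineq.mono fun _ h => h.1),
    le_of_tendsto_of_tendsto hΛsW hp (hineq.mono fun _ h => h.2)⟩

/-- Registered bookkeeping stub `stub_invVSandwich` of the skeleton (= `cFam_star_sandwich`), through which this
file lands. [cite: CamiaFeng2025, §3.2.3] -/
theorem stub_invVSandwich : CrossLawPositive → ArmDressing.BallConnectivityMoebius → ∀ (n : ℕ) (z : Fin n → EuclideanSpace ℝ (Fin 3)) (r : ℝ), (∀ j, z j ≠ 0) → 0 < r → (∀ j, r < ‖z j‖) → ∀ W Ws : ℝ → ℝ, CFam n z (fun _ => r) z (fun _ => 1) W → CFam n (fun j => (‖z j‖ ^ 2 - r ^ 2)⁻¹ • z j) (fun j => r / (‖z j‖ ^ 2 - r ^ 2)) (fun j => EuclideanGeometry.inversion 0 1 (z j)) (fun j => (‖z j‖ ^ 2)⁻¹) Ws → ∀ ε : ℝ, 0 < ε → ε < 1 → ∀ᶠ η in 𝓝[>] (0:ℝ), W (η * (1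 - ε)) ≤ Ws η ∧ Ws η ≤ W (η * (1 + ε)) :=
  fun hPos hA _ _ _ hz hr hrz _ _ hW hWs _ hε hε1 => cFam_star_sandwich hPos hA hz hr hrz hW hWs hε hε1

end Summit.CriticalPhenomena.Ising3DConformalLimit.Cruxes.ArmDressingGlue.InvBook

end
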